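import Mathlib
import Literature.MathematicalPhysics.StatisticalMechanics.Crystallization
import Literature.MathematicalPhysics.StatisticalMechanics.PeriodicConfigurationSums
import Literature.MathematicalPhysics.StatisticalMechanics.StickyChain

/-!
# Normal form of a one-dimensional lattice of periods: `G = ℤ • v` with `v 0 > 0`

Crux 11959 (`Summit.AtomisticToContinuum.Crystallization.Theses.ThreeConeCertificate.ExactCertificate`),
line closure-makes-nogap-exact, Transfer1D skeleton
(`Summit.AtomisticToContinuum.Crystallization.Cruxes.ExactCertificate.Transfer1D.ExactCertificate1D`),
stub `stub_latticeGenerator1D`.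

What it proves: the lattice of periods `Q.lattice ⊂ ℝ¹` of a periodic configuration of the line
(a discrete, full-rank `ℤ`-submodule) is generated by a single vector `v` with positive
coordinate: `g ∈ Q.lattice ↔ ∃ n : ℤ, g = n • v`.  Pure algebra: `Q.lattice` is a free
`ℤ`-module of rank `1` (`ZLattice.module_free`, `PeriodicConfiguration.finrank_lattice`), so a
basis indexed by `Fin 1` gives a generator `u ≠ 0`, and `v := ±u` has `v 0 > 0`.
-/

noncomputable section

namespace Summit.AtomisticToContinuum.Crystallization.Theorems.ThreeConeCertificateExactCertificate.Transfer1D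

open Literature.MathematicalPhysics.StatisticalMechanics

/-- A one-dimensional lattice of periods has a single non-zero generator: every `g ∈ G` is an
integer multiple of some fixed `u ∈ G`, `u ≠ 0`. -/
private theorem latticeGen_exists_generator (Q : PeriodicConfiguration 1) :
    ∃ u : EuclideanSpace ℝ (Fin 1), u ∈ Q.lattice ∧ u ≠ 0 ∧
      ∀ g ∈ Q.lattice, ∃ n : ℤ, g = n • u := by
  haveI : Module.Free ℤ Q.lattice := ZLattice.module_free ℝ Q.lattice
  haveI : Module.Finite ℤ Q.lattice := ZLattice.module_finite ℝ Q.lattice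
  have hcard : Fintype.card (Module.Free.ChooseBasisIndex ℤ Q.lattice) = 1 := by
    rw [← Module.finrank_eq_card_chooseBasisIndex, Q.finrank_lattice]
  set b : Module.Basis (Fin 1) ℤ Q.lattice :=
    (Module.Free.chooseBasis ℤ Q.lattice).reindex (Fintype.equivFinOfCardEq hcard)
  refine ⟨(b 0 : EuclideanSpace ℝ (Fin 1)), (b 0).2, ?_, ?_⟩
  · have h := b.ne_zero 0
    intro h0
    exact h (Subtype.ext h0)
  · intro g hg
    refine ⟨b.repr ⟨g, hg⟩ 0, ?_⟩
    have hsum := b.sum_repr ⟨g, hg⟩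
    rw [Fin.sum_univ_one] at hsum
    have hval := congrArg Subtype.val hsum
    simpa using hval.symm

/-- **Stub `stub_latticeGenerator1D`.**  The lattice of periods of a periodic configuration of
the line is `ℤ • v` for a vector `v` with positive coordinate `v 0 > 0`. -/
theorem stub_latticeGenerator1D : ∀ Q : PeriodicConfiguration 1,
    ∃ v : EuclideanSpace ℝ (Fin 1), 0 < v 0 ∧
      ∀ g : EuclideanSpace ℝ (Fin 1), g ∈ Q.lattice ↔ ∃ n : ℤ, g = n • v := by
  intro Q
  obtain ⟨u, huL, hu0, hgen⟩ := latticeGen_exists_generator Q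
  have hu00 : u 0 ≠ 0 := by
    intro h
    apply hu0
    ext i
    fin_cases i
    simpa using h
  rcases lt_or_gt_of_ne hu00 with hneg | hpos
  · refine ⟨-u, ?_, ?_⟩
    · show 0 < (-u) 0
      simpa using hneg
    · intro g
      constructor
      · intro hg
        obtain ⟨n, rfl⟩ := hgen g hg
        exact ⟨-n, by simp [smul_neg, neg_smul]⟩
      · rintro ⟨n, rfl⟩
        exact Q.lattice.smul_mem n (Q.lattice.neg_mem huL)
  · refine ⟨u, hpos, ?_⟩
    intro g
    constructor
    · exact hgen g
    · rintro ⟨n, rfl⟩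
      exact Q.lattice.smul_mem n huL

end Summit.AtomisticToContinuum.Crystallization.Theorems.ThreeConeCertificateExactCertificate.Transfer1D
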